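import Mathlib
import HarnessLib
import Summits.HubbardSuperconductivity.HubbardSuperconductivity.Theorems.KLProgrammeKLRegimeSectorSlicePairWtFatIncrSectionalAll
import Summits.HubbardSuperconductivity.HubbardSuperconductivity.Theorems.KLProgrammeKLRegimeSectorSliceFamilyDefectFrames
import Summits.HubbardSuperconductivity.HubbardSuperconductivity.Theorems.KLProgrammeKLRegimeTwoVolumeTowerStepCovSectionalPieces

/-!
# K3 VL child `KLRegimeVolumeLimitV17F2` (stmt-HubbardSuperconductivity-20440), located item #23 «W2-HALF-VL», COV/SEC shallow half, sectional brick S3: the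
# SECTIONAL `(1 + Λ_w·tnorm)`-weighted rows of the FAMILY defect `S(F̃^{K′})ᵀ C^{K} S(F̃^{K′}) − S(F̃^{K})ᵀ C^{K} S(F̃^{K})` for two admissible frames whose band
# increment `e_{K′} − e_K` lies in the two-scale class of a flow piece at depth `x` — generic frames, thresholds as hypotheses, ε-FREE

Cell `gate-hubbard-kl`, seat p3 (g16), lead of #23.  The fixed-time twin of k3c3-p2's `rowSumWt_sliceCT_familySub_bgmFat_le` (p597679): SAME binders minus the
time window `Λ′ < π(2M−5)/β` and the time condition, the weight in the tower's `(1 + Λ_w·tnorm)` currency (`0 ≤ Λ_w ≤ D·ρ/x`, `1 ≤ D`).  Proof =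
`slicePairWt_bgmFatIncr_sectional_le_all` (S1) twice (increment pair with co-factor on `K`, and with co-factor on `K′` with the tangency transferred by
`G₁/x`), the pair-difference split into those two native increment pairs (`norm_charSum_pairSub_le_add_incr`), the rate-weight currency
(`secWt_tnorm_le_of_rateWt`) and p3 g13's `secRowWt_sliceCT_familySub_le`.

* `norm_charSum_pairSub_le_add_incr` — `‖S[(F′_ωF′_{ω′} − F_ωF_{ω′})p]‖ ≤ ‖S[(F_ωF′_{ω′} − F′_ωF′_{ω′})p]‖ + ‖S[(F′_{ω′}F_ω − F_{ω′}F_ω)p]‖`;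
* **`secRowWt_sliceCT_familySub_bgmFat_le`** — `Σ_y ‖Fam X ((t,y),ℓ)‖·(1 + Λ_w·tnorm(x⃗ − y)) ≤ 2·(D·T_s(x) + D·T_s(x))`,
  `T_s(x) = (Λ_mβ/π + 3)·(x·√Ŵ·√(24·L²·N̄_cell)·(𝔅₀(x)·(βL²)⁻²·4βL²/Λ))` — net `x⁻¹`, no `2M`.

Everything is proved; no definitions, no sorry.  Nothing asserts any stub, K3, VL or superconductivity. [cite: BenfattoGiulianiMastropietro2006, §2.7 (2.66)–(2.67), §2.8 (2.81), §3 (3.2)–(3.8)]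
-/

noncomputable section

namespace Summit.HubbardSuperconductivity.HubbardSuperconductivity.Theorems.TorusFourierL2

set_option linter.dupNamespace false -- summit = problem name (single-conjunct summit), D-0017

open Set Finset Filter Topology Literature.MathematicalPhysics.QuantumLattice Literature.MathematicalPhysics.QuantumLattice.BandSectorCounting
open Literature.MathematicalPhysics.QuantumLattice.FermiRG Literature.Probability.LatticeModels Literature.Analysis.SpecialFunctions Literature.Analysis.Calculus
open Summit.HubbardSuperconductivity.HubbardSuperconductivity.Theorems.DispersionFlow
open Summit.HubbardSuperconductivity.HubbardSuperconductivity.Theorems.KLRegimeSplit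
open Summit.HubbardSuperconductivity.HubbardSuperconductivity.Theorems.KLProgrammeLegKernels
open Summit.HubbardSuperconductivity.HubbardSuperconductivity.Theorems.PerturbedFermiCurve
open scoped Real Nat

/-- **The pair-difference character sum splits into the two NATIVE increment pairs of brick S1** (pointwise in `(z₁, z₂)`):
`F′_ωF′_{ω′} − F_ωF_{ω′} = −(F_ωF′_{ω′} − F′_ωF′_{ω′}) + (F′_{ω′}F_ω − F_{ω′}F_ω)`. [folklore] -/
theorem norm_charSum_pairSub_le_add_incr {L M N : ℕ} [NeZero L] [NeZero M] (c : ℂ) (F' F : Fin N → FreqMomentum L M → ℂ) (p : FreqMomentum L M → ℂ) (ω ω' : Fin N)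
    (z₁ : TorusSite 1 (2 * M)) (z₂ : TorusSite 2 L) :
    ‖∑ q : TorusSite 1 (2 * M) × TorusSite 2 L, (torusChar q.1 z₁ * torusChar q.2 z₂) •
        (c * ((F' ω (⟨(q.1 0).val, ZMod.val_lt (q.1 0)⟩, q.2) * F' ω' (⟨(q.1 0).val, ZMod.val_lt (q.1 0)⟩, q.2) - F ω (⟨(q.1 0).val, ZMod.val_lt (q.1 0)⟩, q.2) * F ω' (⟨(q.1 0).val, ZMod.val_lt (q.1 0)⟩, q.2)) * p (⟨(q.1 0).val, ZMod.val_lt (q.1 0)⟩, q.2)))‖ ≤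
      ‖∑ q : TorusSite 1 (2 * M) × TorusSite 2 L, (torusChar q.1 z₁ * torusChar q.2 z₂) •
          (c * ((F ω (⟨(q.1 0).val, ZMod.val_lt (q.1 0)⟩, q.2) * F' ω' (⟨(q.1 0).val, ZMod.val_lt (q.1 0)⟩, q.2) - F' ω (⟨(q.1 0).val, ZMod.val_lt (q.1 0)⟩, q.2) * F' ω' (⟨(q.1 0).val, ZMod.val_lt (q.1 0)⟩, q.2)) * p (⟨(q.1 0).val, ZMod.val_lt (q.1 0)⟩, q.2)))‖ +
      ‖∑ q : TorusSite 1 (2 * M) × TorusSite 2 L, (torusChar q.1 z₁ * torusChar q.2 z₂) •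
          (c * ((F' ω' (⟨(q.1 0).val, ZMod.val_lt (q.1 0)⟩, q.2) * F ω (⟨(q.1 0).val, ZMod.val_lt (q.1 0)⟩, q.2) - F ω' (⟨(q.1 0).val, ZMod.val_lt (q.1 0)⟩, q.2) * F ω (⟨(q.1 0).val, ZMod.val_lt (q.1 0)⟩, q.2)) * p (⟨(q.1 0).val, ZMod.val_lt (q.1 0)⟩, q.2)))‖ := by
  rw [← norm_neg (∑ q : TorusSite 1 (2 * M) × TorusSite 2 L, (torusChar q.1 z₁ * torusChar q.2 z₂) •
          (c * ((F ω (⟨(q.1 0).val, ZMod.val_lt (q.1 0)⟩, q.2) * F' ω' (⟨(q.1 0).val, ZMod.val_lt (q.1 0)⟩, q.2) - F' ω (⟨(q.1 0).val, ZMod.val_lt (q.1 0)⟩, q.2) * F' ω' (⟨(q.1 0).val, ZMod.val_lt (q.1 0)⟩, q.2)) * p (⟨(q.1 0).val, ZMod.val_lt (q.1 0)⟩, q.2))))]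
  refine le_trans (le_of_eq ?_) (norm_add_le _ _)
  rw [← Finset.sum_neg_distrib, ← Finset.sum_add_distrib]
  congr 1
  refine Finset.sum_congr rfl fun q _ => ?_
  rw [← smul_neg, ← smul_add]
  congr 1
  ring

section FamDefectSec

open Classical

variable {L M : ℕ} [NeZero L] [NeZero M] {a b : ℝ} (B : BandBounds a b) {K K' : TrigPolyC4v} {A A₃ : ℝ}
  (hA : ∀ p : Momentum, ∀ j ≤ 2, ‖iteratedFDeriv ℝ j (frameShift K) p‖ ≤ A) (hA3 : ∀ p : Momentum, ‖iteratedFDeriv ℝ 3 (frameShift K) p‖ ≤ A₃)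
  (hA' : ∀ p : Momentum, ∀ j ≤ 2, ‖iteratedFDeriv ℝ j (frameShift K') p‖ ≤ A) (hA3' : ∀ p : Momentum, ‖iteratedFDeriv ℝ 3 (frameShift K') p‖ ≤ A₃)
  (hADt : 2 * A < B.Dtmin)
  {μ e₀ z β : ℝ} (he : 0 < e₀) (hz : 0 < z) (hz1 : z ≤ 1) (hgap : e₀ + A + z ^ 2 < -μ) (h3 : e₀ + A - μ ≤ 3)
  (hlo : a ≤ μ - A - e₀) (hhi : μ + A + e₀ ≤ b) (hβ : 0 < β) (hρA : 4 * A < 2 * B.rhomin)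
  (m : ℕ) (hMm : klScale e₀ m * β < π * (2 * M - 5))
  {d : ℝ} (hd : 0 ≤ d) (hd1 : ∀ u, |deriv (bgmCutoffSq e₀) u| ≤ d) (hd2 : ∀ u, |iteratedDeriv 2 (bgmCutoffSq e₀) u| ≤ d)
  (hd3 : ∀ u, |iteratedDeriv 3 (bgmCutoffSq e₀) u| ≤ d) (hd4 : ∀ u, |iteratedDeriv 4 (bgmCutoffSq e₀) u| ≤ d)
  {Ba : ℝ} (hB0 : 0 ≤ Ba)
  (hB : ∀ (i : ℕ), i ≤ 3 → ∀ (n : ℕ) (ω : ℤ) (θ₀ : ℝ) (q w : Fin 2 → ℝ) (t : ℝ) {r₀ : ℝ}, 0 < r₀ →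
    r₀ ≤ ‖momToComplex (q + t • w)‖ → |sectorRelAngle θ₀ (q + t • w)| < π →
    ‖iteratedDeriv i (fun t : ℝ => sectorWeightCirc n ω (polarAngle (q + t • w))) t‖ ≤
      (3 : ℕ)! * Ba * ((1 + (sectorWidth n)⁻¹ * (3 : ℕ)!) * ‖momToComplex w‖ / r₀) ^ i)
  {K₂ : ℝ} (hK₂ : ∀ p, ‖iteratedFDeriv ℝ 2 (frameLevel μ K) p‖ ≤ K₂) (hK₂' : ∀ p, ‖iteratedFDeriv ℝ 2 (frameLevel μ K') p‖ ≤ K₂)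
  {Nr : ℝ} (hNr : 2 ≤ Nr) (hLz : 3 * |2 * π / L| * (Nr + 1 / 2) ≤ z)
  -- the band increment `e_{K′} − e_K` (Euclidean jets) in the two-scale class at depth `x`
  {x G₀ G₁ G₂ G₃ ε₃₀ ε₃₁ : ℝ} (hx : 1 ≤ x) (hG₀ : 0 < G₀) (hG₁ : 0 ≤ G₁) (hG₂ : 0 ≤ G₂) (hG₃ : 0 ≤ G₃) (hε₃₀ : 0 ≤ ε₃₀) (hε₃₁ : 0 ≤ ε₃₁)
  (hv₀ : ∀ p : Momentum, |frameLevel μ K' p - frameLevel μ K p| ≤ G₀ / x ^ 2)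
  (hv₁ : ∀ p : Momentum, ‖fderiv ℝ (fun p => frameLevel μ K' p - frameLevel μ K p) p‖ ≤ G₁ / x)
  (hv₂ : ∀ p : Momentum, ‖iteratedFDeriv ℝ 2 (fun p => frameLevel μ K' p - frameLevel μ K p) p‖ ≤ G₂)
  (hv₃ : ∀ p : Momentum, ‖iteratedFDeriv ℝ 3 (fun p => frameLevel μ K' p - frameLevel μ K p) p‖ ≤ G₃ * x)
  (hGΛ : G₀ / x ^ 2 ≤ klScale e₀ m) (hA₃x : 4 + 8 * A₃ ≤ ε₃₀ + ε₃₁ * x)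
  -- the band frame `K`: slice, jets in the class, cutoff
  {Λ Λ' : ℝ} (hΛ : 0 < Λ) (hΛΛ' : Λ ≤ Λ')
  {Kb₁ Kb₂ Kb₃ : ℝ} (hKb₁ : ∀ p, ‖fderiv ℝ (frameLevel μ K) p‖ ≤ Kb₁) (hKb₂ : ∀ p, ‖iteratedFDeriv ℝ 2 (frameLevel μ K) p‖ ≤ Kb₂)
  (hKb₃ : ∀ p, ‖iteratedFDeriv ℝ 3 (frameLevel μ K) p‖ ≤ Kb₃)
  {bs b₂ b₂' b₃ b₃' : ℝ} (hbs : 0 ≤ bs) (hKb₁b : Kb₁ ≤ bs) (hKb₂x : Kb₂ ≤ b₂ + b₂' * x) (hKb₃x : Kb₃ ≤ b₃ + b₃' * x)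
  {B₁ B₂ B₃ : ℝ} (hB₁ : ∀ x, |deriv salmhoferCutoff x| ≤ B₁) (hB₂ : ∀ x, |deriv (deriv salmhoferCutoff) x| ≤ B₂)
  (hB₃ : ∀ x, |deriv (deriv (deriv salmhoferCutoff)) x| ≤ B₃)
  -- the names (instantiate with `rfl`): common, iso family, tangent family, time
  {ρf κ C₁ B₀x ε₂ ζ t 𝔮₁ 𝔮₂ 𝔮₃₀ 𝔮₃₁ d₁ w₁ d₂ w₂ d₃₀ d₃₁ w₃₀ w₃₁ o₁₀ o₁₁ o₂₀ o₂₁ o₂₂ o₃₀ o₃₁ o₃₂ o₃₃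
    R₁₀ R₁₁ R₂₀ R₂₁ R₂₂ R₃₀ R₃₁ R₃₂ R₃₃ r₁₀ r₁₁ r₂₀ r₂₁ r₂₂ r₃₀ r₃₁ r₃₂ r₃₃
    tv 𝔳₁ 𝔳₂ 𝔳₃₀ 𝔳₃₁ dv₁ wv₁ dv₂ wv₂ dv₃₀ dv₃₁ wv₃₀ wv₃₁ ov₁₀ ov₁₁ ov₂₀ ov₂₁ ov₂₂ ov₃₀ ov₃₁ ov₃₂ ov₃₃
    Rv₁₀ Rv₁₁ Rv₂₀ Rv₂₁ Rv₂₂ Rv₃₀ Rv₃₁ Rv₃₂ Rv₃₃ rv₁₀ rv₁₁ rv₂₀ rv₂₁ rv₂₂ rv₃₀ rv₃₁ rv₃₂ rv₃₃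
    qt₁ qt₂ qt₃ Dt₁ Dt₂ θ₁ θ₂ θ₃ : ℝ}
  (hρf : ρf = (klScale e₀ m + B.smax * B.Dtmin * (3 * sectorWidth (m + 1) / 4)) / (B.Dtmin - 2 * A) +
    π * Real.sqrt 2 * (1 + (4 + 2 * A) / (B.Dtmin - 2 * A)) * sectorWidth (m + 1))
  (hκ : κ = e₀ ^ 2 / klScale e₀ m ^ 2) (hC₁ : C₁ = d * e₀ ^ 2 / klScale e₀ m ^ 2)
  (hB₀x : B₀x = C₁ * (G₀ / x ^ 2 * (2 * (klScale e₀ m + G₀ / x ^ 2) + G₀ / x ^ 2)))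
  (hε₂ : ε₂ = 4 + 4 * A) (hζ : ζ = 1 + 6 * (sectorWidth (m + 1))⁻¹)
  -- iso family (`t = 4 + 2A`)
  (ht : t = 4 + 2 * A)
  (h𝔮₁ : 𝔮₁ = 2 * (d * e₀ ^ 2) * t / klScale e₀ m + 9 * (12 * Ba * ζ))
  (h𝔮₂ : 𝔮₂ = (4 * (d * e₀ ^ 4) + 2 * (d * e₀ ^ 2)) * t ^ 2 / klScale e₀ m ^ 2 + 2 * (d * e₀ ^ 2) * (4 + 4 * A) / klScale e₀ m +
    4 * (d * e₀ ^ 2) * t / klScale e₀ m * (9 * (12 * Ba * ζ)) + 9 * ((12 * Ba + 72 * Ba ^ 2) * ζ ^ 2))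
  (h𝔮₃₀ : 𝔮₃₀ = (8 * (d * e₀ ^ 6) + 12 * (d * e₀ ^ 4)) * t ^ 3 / klScale e₀ m ^ 3 + (12 * (d * e₀ ^ 4) + 6 * (d * e₀ ^ 2)) * (t * (4 + 4 * A)) / klScale e₀ m ^ 2 +
    2 * (d * e₀ ^ 2) * ε₃₀ / klScale e₀ m +
    3 * (((4 * (d * e₀ ^ 4) + 2 * (d * e₀ ^ 2)) * t ^ 2 / klScale e₀ m ^ 2 + 2 * (d * e₀ ^ 2) * (4 + 4 * A) / klScale e₀ m) * (9 * (12 * Ba * ζ))) +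
    3 * (2 * (d * e₀ ^ 2) * t / klScale e₀ m * (9 * ((12 * Ba + 72 * Ba ^ 2) * ζ ^ 2))) + 9 * ((12 * Ba + 216 * Ba ^ 2) * ζ ^ 3))
  (h𝔮₃₁ : 𝔮₃₁ = 2 * (d * e₀ ^ 2) * ε₃₁ / klScale e₀ m)
  (hd₁ : d₁ = 4 * klScale e₀ m * t) (hw₁ : w₁ = 2 * (t * G₀ + 2 * klScale e₀ m * (2 * G₁) + G₀ * (2 * G₁))) (hd₂ : d₂ = 2 * (t ^ 2 + 2 * klScale e₀ m * ε₂))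
  (hw₂ : w₂ = 2 * (ε₂ * G₀ + 2 * t * (2 * G₁) + 2 * klScale e₀ m * (4 * G₂) + (2 * G₁) ^ 2 + G₀ * (4 * G₂)))
  (hd₃₀ : d₃₀ = 2 * (3 * t * ε₂ + 2 * klScale e₀ m * ε₃₀)) (hd₃₁ : d₃₁ = 4 * klScale e₀ m * ε₃₁)
  (hw₃₀ : w₃₀ = 2 * (ε₃₀ * G₀ + ε₃₁ * G₀ + 3 * ε₂ * (2 * G₁) + 3 * t * (4 * G₂) + 3 * (2 * G₁) * (4 * G₂) + G₀ * (8 * G₃))) (hw₃₁ : w₃₁ = 4 * klScale e₀ m * (8 * G₃))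
  (ho₁₀ : o₁₀ = t / klScale e₀ m) (ho₁₁ : o₁₁ = 2 * (2 * G₁) / G₀) (ho₂₀ : o₂₀ = ε₂ / klScale e₀ m + (2 * G₁) ^ 2 / (klScale e₀ m * G₀))
  (ho₂₁ : o₂₁ = 2 * t * (2 * G₁) / (klScale e₀ m * G₀)) (ho₂₂ : o₂₂ = 2 * (4 * G₂) / G₀)
  (ho₃₀ : o₃₀ = ε₃₀ / klScale e₀ m) (ho₃₁ : o₃₁ = ε₃₁ / klScale e₀ m + 3 * ε₂ * (2 * G₁) / (klScale e₀ m * G₀) + 3 * (2 * G₁) * (4 * G₂) / (klScale e₀ m * G₀))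
  (ho₃₂ : o₃₂ = 3 * t * (4 * G₂) / (klScale e₀ m * G₀)) (ho₃₃ : o₃₃ = 2 * (8 * G₃) / G₀)
  (hR₁₀ : R₁₀ = κ * (d₁ + w₁) + o₁₀) (hR₁₁ : R₁₁ = o₁₁)
  (hR₂₀ : R₂₀ = κ ^ 2 * (d₁ + w₁) ^ 2 + κ * (o₁₀ * (2 * d₁ + w₁)) + κ * (d₂ + w₂) + o₂₀) (hR₂₁ : R₂₁ = κ * (o₁₁ * (2 * d₁ + w₁)) + o₂₁)
  (hR₂₂ : R₂₂ = o₂₂)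
  (hR₃₀ : R₃₀ = κ ^ 3 * (d₁ + w₁) ^ 3 + κ ^ 2 * (o₁₀ * (3 * d₁ ^ 2 + 3 * d₁ * w₁ + w₁ ^ 2)) +
    3 * (κ ^ 2 * ((d₁ + w₁) * (d₂ + w₂)) + κ * (d₁ * o₂₀ + o₁₀ * d₂ + o₁₀ * w₂)) + κ * (d₃₀ + w₃₀) + o₃₀)
  (hR₃₁ : R₃₁ = κ ^ 2 * (o₁₁ * (3 * d₁ ^ 2 + 3 * d₁ * w₁ + w₁ ^ 2)) + 3 * (κ * (d₁ * o₂₁ + o₁₁ * d₂ + o₁₁ * w₂)) + κ * (d₃₁ + w₃₁) + o₃₁)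
  (hR₃₂ : R₃₂ = 3 * (κ * (d₁ * o₂₂)) + o₃₂) (hR₃₃ : R₃₃ = o₃₃)
  (hr₁₀ : r₁₀ = R₁₀ + 𝔮₁) (hr₁₁ : r₁₁ = R₁₁) (hr₂₀ : r₂₀ = R₂₀ + 2 * R₁₀ * 𝔮₁ + 𝔮₂) (hr₂₁ : r₂₁ = R₂₁ + 2 * R₁₁ * 𝔮₁) (hr₂₂ : r₂₂ = R₂₂)
  (hr₃₀ : r₃₀ = R₃₀ + 3 * R₂₀ * 𝔮₁ + 3 * R₁₀ * 𝔮₂ + 𝔮₃₀) (hr₃₁ : r₃₁ = R₃₁ + 3 * R₂₁ * 𝔮₁ + 3 * R₁₁ * 𝔮₂ + 𝔮₃₁)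
  (hr₃₂ : r₃₂ = R₃₂ + 3 * R₂₂ * 𝔮₁) (hr₃₃ : r₃₃ = R₃₃)
  -- tangent family (`t_v = (4+2A)/(N_r−1) + K₂√2ρ_f`)
  (htv : tv = (4 + 2 * A) / (Nr - 1) + K₂ * (Real.sqrt 2 * ρf))
  (h𝔳₁ : 𝔳₁ = 2 * (d * e₀ ^ 2) * tv / klScale e₀ m + 9 * (12 * Ba * ζ))
  (h𝔳₂ : 𝔳₂ = (4 * (d * e₀ ^ 4) + 2 * (d * e₀ ^ 2)) * tv ^ 2 / klScale e₀ m ^ 2 + 2 * (d * e₀ ^ 2) * (4 + 4 * A) / klScale e₀ m +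
    4 * (d * e₀ ^ 2) * tv / klScale e₀ m * (9 * (12 * Ba * ζ)) + 9 * ((12 * Ba + 72 * Ba ^ 2) * ζ ^ 2))
  (h𝔳₃₀ : 𝔳₃₀ = (8 * (d * e₀ ^ 6) + 12 * (d * e₀ ^ 4)) * tv ^ 3 / klScale e₀ m ^ 3 + (12 * (d * e₀ ^ 4) + 6 * (d * e₀ ^ 2)) * (tv * (4 + 4 * A)) / klScale e₀ m ^ 2 +
    2 * (d * e₀ ^ 2) * ε₃₀ / klScale e₀ m +
    3 * (((4 * (d * e₀ ^ 4) + 2 * (d * e₀ ^ 2)) * tv ^ 2 / klScale e₀ m ^ 2 + 2 * (d * e₀ ^ 2) * (4 + 4 * A) / klScale e₀ m) * (9 * (12 * Ba * ζ))) +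
    3 * (2 * (d * e₀ ^ 2) * tv / klScale e₀ m * (9 * ((12 * Ba + 72 * Ba ^ 2) * ζ ^ 2))) + 9 * ((12 * Ba + 216 * Ba ^ 2) * ζ ^ 3))
  (h𝔳₃₁ : 𝔳₃₁ = 2 * (d * e₀ ^ 2) * ε₃₁ / klScale e₀ m)
  (hdv₁ : dv₁ = 4 * klScale e₀ m * tv) (hwv₁ : wv₁ = 2 * (tv * G₀ + 2 * klScale e₀ m * (2 * G₁) + G₀ * (2 * G₁))) (hdv₂ : dv₂ = 2 * (tv ^ 2 + 2 * klScale e₀ m * ε₂))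
  (hwv₂ : wv₂ = 2 * (ε₂ * G₀ + 2 * tv * (2 * G₁) + 2 * klScale e₀ m * (4 * G₂) + (2 * G₁) ^ 2 + G₀ * (4 * G₂)))
  (hdv₃₀ : dv₃₀ = 2 * (3 * tv * ε₂ + 2 * klScale e₀ m * ε₃₀)) (hdv₃₁ : dv₃₁ = 4 * klScale e₀ m * ε₃₁)
  (hwv₃₀ : wv₃₀ = 2 * (ε₃₀ * G₀ + ε₃₁ * G₀ + 3 * ε₂ * (2 * G₁) + 3 * tv * (4 * G₂) + 3 * (2 * G₁) * (4 * G₂) + G₀ * (8 * G₃))) (hwv₃₁ : wv₃₁ = 4 * klScale e₀ m * (8 * G₃))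
  (hov₁₀ : ov₁₀ = tv / klScale e₀ m) (hov₁₁ : ov₁₁ = 2 * (2 * G₁) / G₀) (hov₂₀ : ov₂₀ = ε₂ / klScale e₀ m + (2 * G₁) ^ 2 / (klScale e₀ m * G₀))
  (hov₂₁ : ov₂₁ = 2 * tv * (2 * G₁) / (klScale e₀ m * G₀)) (hov₂₂ : ov₂₂ = 2 * (4 * G₂) / G₀)
  (hov₃₀ : ov₃₀ = ε₃₀ / klScale e₀ m) (hov₃₁ : ov₃₁ = ε₃₁ / klScale e₀ m + 3 * ε₂ * (2 * G₁) / (klScale e₀ m * G₀) + 3 * (2 * G₁) * (4 * G₂) / (klScale e₀ m * G₀))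
  (hov₃₂ : ov₃₂ = 3 * tv * (4 * G₂) / (klScale e₀ m * G₀)) (hov₃₃ : ov₃₃ = 2 * (8 * G₃) / G₀)
  (hRv₁₀ : Rv₁₀ = κ * (dv₁ + wv₁) + ov₁₀) (hRv₁₁ : Rv₁₁ = ov₁₁)
  (hRv₂₀ : Rv₂₀ = κ ^ 2 * (dv₁ + wv₁) ^ 2 + κ * (ov₁₀ * (2 * dv₁ + wv₁)) + κ * (dv₂ + wv₂) + ov₂₀) (hRv₂₁ : Rv₂₁ = κ * (ov₁₁ * (2 * dv₁ + wv₁)) + ov₂₁)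
  (hRv₂₂ : Rv₂₂ = ov₂₂)
  (hRv₃₀ : Rv₃₀ = κ ^ 3 * (dv₁ + wv₁) ^ 3 + κ ^ 2 * (ov₁₀ * (3 * dv₁ ^ 2 + 3 * dv₁ * wv₁ + wv₁ ^ 2)) +
    3 * (κ ^ 2 * ((dv₁ + wv₁) * (dv₂ + wv₂)) + κ * (dv₁ * ov₂₀ + ov₁₀ * dv₂ + ov₁₀ * wv₂)) + κ * (dv₃₀ + wv₃₀) + ov₃₀)
  (hRv₃₁ : Rv₃₁ = κ ^ 2 * (ov₁₁ * (3 * dv₁ ^ 2 + 3 * dv₁ * wv₁ + wv₁ ^ 2)) + 3 * (κ * (dv₁ * ov₂₁ + ov₁₁ * dv₂ + ov₁₁ * wv₂)) + κ * (dv₃₁ + wv₃₁) + ov₃₁)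
  (hRv₃₂ : Rv₃₂ = 3 * (κ * (dv₁ * ov₂₂)) + ov₃₂) (hRv₃₃ : Rv₃₃ = ov₃₃)
  (hrv₁₀ : rv₁₀ = Rv₁₀ + 𝔳₁) (hrv₁₁ : rv₁₁ = Rv₁₁) (hrv₂₀ : rv₂₀ = Rv₂₀ + 2 * Rv₁₀ * 𝔳₁ + 𝔳₂) (hrv₂₁ : rv₂₁ = Rv₂₁ + 2 * Rv₁₁ * 𝔳₁) (hrv₂₂ : rv₂₂ = Rv₂₂)
  (hrv₃₀ : rv₃₀ = Rv₃₀ + 3 * Rv₂₀ * 𝔳₁ + 3 * Rv₁₀ * 𝔳₂ + 𝔳₃₀) (hrv₃₁ : rv₃₁ = Rv₃₁ + 3 * Rv₂₁ * 𝔳₁ + 3 * Rv₁₁ * 𝔳₂ + 𝔳₃₁)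
  (hrv₃₂ : rv₃₂ = Rv₃₂ + 3 * Rv₂₂ * 𝔳₁) (hrv₃₃ : rv₃₃ = Rv₃₃)
  -- time
  (hqt₁ : qt₁ = 2 * (d * e₀ ^ 2) * |2 * π / β| / klScale e₀ m) (hqt₂ : qt₂ = (4 * (d * e₀ ^ 4) + 2 * (d * e₀ ^ 2)) * (2 * π / β) ^ 2 / klScale e₀ m ^ 2)
  (hqt₃ : qt₃ = (8 * (d * e₀ ^ 6) + 12 * (d * e₀ ^ 4)) * |2 * π / β| ^ 3 / klScale e₀ m ^ 3)
  (hDt₁ : Dt₁ = 2 * klScale e₀ m * |2 * π / β|) (hDt₂ : Dt₂ = 2 * (2 * π / β) ^ 2)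
  (hθ₁ : θ₁ = κ * Dt₁ + qt₁) (hθ₂ : θ₂ = κ ^ 2 * Dt₁ ^ 2 + κ * Dt₂ + 2 * (κ * Dt₁) * qt₁ + qt₂)
  (hθ₃ : θ₃ = κ ^ 3 * Dt₁ ^ 3 + 3 * (κ ^ 2 * (Dt₁ * Dt₂)) + 3 * ((κ ^ 2 * Dt₁ ^ 2 + κ * Dt₂) * qt₁) + 3 * (κ * Dt₁ * qt₂) + qt₃)
  -- the slot constant dominates the tangent slot plus the transfer `G₁/x`
  (htvb : tv + G₁ / x ≤ bs)

include B hA hA3 hA' hA3' hADt he hz hz1 hgap h3 hlo hhi hβ hρA hMm hd hd1 hd2 hd3 hd4 hB0 hB hK₂ hK₂' hNr hLz hx hG₀ hG₁ hG₂ hG₃ hε₃₀ hε₃₁ hv₀ hv₁ hv₂ hv₃ hGΛ hA₃x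
  hΛ hΛΛ' hKb₁ hKb₂ hKb₃ hbs hKb₁b hKb₂x hKb₃x hB₁ hB₂ hB₃ hρf hκ hC₁ hB₀x hε₂ hζ ht h𝔮₁ h𝔮₂ h𝔮₃₀ h𝔮₃₁
  hd₁ hw₁ hd₂ hw₂ hd₃₀ hd₃₁ hw₃₀ hw₃₁ ho₁₀ ho₁₁ ho₂₀ ho₂₁ ho₂₂ ho₃₀ ho₃₁ ho₃₂ ho₃₃ hR₁₀ hR₁₁ hR₂₀ hR₂₁ hR₂₂ hR₃₀ hR₃₁ hR₃₂ hR₃₃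
  hr₁₀ hr₁₁ hr₂₀ hr₂₁ hr₂₂ hr₃₀ hr₃₁ hr₃₂ hr₃₃ htv h𝔳₁ h𝔳₂ h𝔳₃₀ h𝔳₃₁
  hdv₁ hwv₁ hdv₂ hwv₂ hdv₃₀ hdv₃₁ hwv₃₀ hwv₃₁ hov₁₀ hov₁₁ hov₂₀ hov₂₁ hov₂₂ hov₃₀ hov₃₁ hov₃₂ hov₃₃ hRv₁₀ hRv₁₁ hRv₂₀ hRv₂₁ hRv₂₂ hRv₃₀ hRv₃₁ hRv₃₂ hRv₃₃
  hrv₁₀ hrv₁₁ hrv₂₀ hrv₂₁ hrv₂₂ hrv₃₀ hrv₃₁ hrv₃₂ hrv₃₃ hqt₁ hqt₂ hqt₃ hDt₁ hDt₂ hθ₁ hθ₂ hθ₃ htvb in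
set_option maxHeartbeats 4000000 in
/-- **Sectional `(1 + Λ_w·tnorm)`-rows of the family defect of two admissible frames in the two-scale class** (see the module docstring).
[cite: BenfattoGiulianiMastropietro2006, §2.7 (2.66)–(2.67), §2.8 (2.81), §3 (3.2)–(3.8)] -/
theorem secRowWt_sliceCT_familySub_bgmFat_le
    -- lattice resolution of the band frame's curvature (uniform in the frame vector)
    (hLe : Kb₂ * (2 * π / L) ≤ bs) (hLv : Kb₂ * (2 * π / L * (Real.sqrt 2 * (Nr + 1 / 2))) ≤ bs)
    -- rates (`s₀ > 0` free), coefficients, thresholds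
    {s₀ ρ ρ₃ k₁ k₂ k₃ : ℝ} (hs₀ : 0 < s₀) (hρ : 0 < ρ) (hρ₃ : 0 < ρ₃)
    (hk₁ : k₁ = (16 * B₁ + 16) / Λ ^ 2) (hk₂ : k₂ = (32 * B₂ + 144 * B₁ + 128) / Λ ^ 3) (hk₃ : k₃ = (64 * B₃ + 480 * B₂ + 1728 * B₁ + 1536) / Λ ^ 4)
    {C₀ C₁' C₂ C₃ Cv₀ Cv₁ Cv₂ Cv₃ Cw₀ Cw₁ Cw₂ Kc Kw : ℝ}
    (hC₀ : C₀ = 343 * k₃ * (β * (L : ℝ) ^ 2) * bs ^ 3 + 21 * k₂ * (β * (L : ℝ) ^ 2) * bs * b₂ + k₁ * (β * (L : ℝ) ^ 2) * b₃ +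
      3 * r₁₀ * (36 * k₂ * (β * (L : ℝ) ^ 2) * bs ^ 2 + k₁ * (β * (L : ℝ) ^ 2) * b₂) + 15 * r₂₀ * k₁ * (β * (L : ℝ) ^ 2) * bs + r₃₀ * (4 * (β * (L : ℝ) ^ 2) / Λ))
    (hC₁' : C₁' = 21 * k₂ * (β * (L : ℝ) ^ 2) * bs * b₂' + k₁ * (β * (L : ℝ) ^ 2) * b₃' + 3 * r₁₁ * (36 * k₂ * (β * (L : ℝ) ^ 2) * bs ^ 2 + k₁ * (β * (L : ℝ) ^ 2) * b₂) +
      3 * r₁₀ * (k₁ * (β * (L : ℝ) ^ 2) * b₂') + 15 * r₂₁ * k₁ * (β * (L : ℝ) ^ 2) * bs + r₃₁ * (4 * (β * (L : ℝ) ^ 2) / Λ))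
    (hC₂ : C₂ = 3 * r₁₁ * (k₁ * (β * (L : ℝ) ^ 2) * b₂') + 15 * r₂₂ * k₁ * (β * (L : ℝ) ^ 2) * bs + r₃₂ * (4 * (β * (L : ℝ) ^ 2) / Λ))
    (hC₃ : C₃ = r₃₃ * (4 * (β * (L : ℝ) ^ 2) / Λ))
    (hCv₀ : Cv₀ = 343 * k₃ * (β * (L : ℝ) ^ 2) * bs ^ 3 + 21 * k₂ * (β * (L : ℝ) ^ 2) * bs * b₂ + k₁ * (β * (L : ℝ) ^ 2) * b₃ +
      3 * rv₁₀ * (36 * k₂ * (β * (L : ℝ) ^ 2) * bs ^ 2 + k₁ * (β * (L : ℝ) ^ 2) * b₂) + 15 * rv₂₀ * k₁ * (β * (L : ℝ) ^ 2) * bs + rv₃₀ * (4 * (β * (L : ℝ) ^ 2) / Λ))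
    (hCv₁ : Cv₁ = 21 * k₂ * (β * (L : ℝ) ^ 2) * bs * b₂' + k₁ * (β * (L : ℝ) ^ 2) * b₃' + 3 * rv₁₁ * (36 * k₂ * (β * (L : ℝ) ^ 2) * bs ^ 2 + k₁ * (β * (L : ℝ) ^ 2) * b₂) +
      3 * rv₁₀ * (k₁ * (β * (L : ℝ) ^ 2) * b₂') + 15 * rv₂₁ * k₁ * (β * (L : ℝ) ^ 2) * bs + rv₃₁ * (4 * (β * (L : ℝ) ^ 2) / Λ))
    (hCv₂ : Cv₂ = 3 * rv₁₁ * (k₁ * (β * (L : ℝ) ^ 2) * b₂') + 15 * rv₂₂ * k₁ * (β * (L : ℝ) ^ 2) * bs + rv₃₂ * (4 * (β * (L : ℝ) ^ 2) / Λ))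
    (hCv₃ : Cv₃ = rv₃₃ * (4 * (β * (L : ℝ) ^ 2) / Λ))
    (hCw₀ : Cw₀ = 25 * k₂ * (β * (L : ℝ) ^ 2) * bs ^ 2 + k₁ * (β * (L : ℝ) ^ 2) * b₂ + 8 * rv₁₀ * k₁ * (β * (L : ℝ) ^ 2) * bs + rv₂₀ * (4 * (β * (L : ℝ) ^ 2) / Λ))
    (hCw₁ : Cw₁ = k₁ * (β * (L : ℝ) ^ 2) * b₂' + 8 * rv₁₁ * k₁ * (β * (L : ℝ) ^ 2) * bs + rv₂₁ * (4 * (β * (L : ℝ) ^ 2) / Λ))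
    (hCw₂ : Cw₂ = rv₂₂ * (4 * (β * (L : ℝ) ^ 2) / Λ))
    (hKc : Kc = 32 * (β * (L : ℝ) ^ 2) / (π ^ 3 * Λ)) (hKw : Kw = 16 * (β * (L : ℝ) ^ 2) / (π ^ 2 * Λ))
    (th₃ : 4 * C₃ * ρ ^ 3 ≤ Kc) (th₂ : 4 * C₂ * ρ ^ 3 ≤ Kc * x) (th₁ : 4 * C₁' * ρ ^ 3 ≤ Kc * x ^ 2) (th₀ : 4 * C₀ * ρ ^ 3 ≤ Kc * x ^ 3)
    (tv₃ : 4 * Cv₃ * ρ ^ 3 ≤ Kc) (tv₂ : 4 * Cv₂ * ρ ^ 3 ≤ Kc * x) (tv₁ : 4 * Cv₁ * ρ ^ 3 ≤ Kc * x ^ 2) (tv₀ : 4 * Cv₀ * ρ ^ 3 ≤ Kc * x ^ 3)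
    (tw₂ : 3 * Cw₂ * ρ₃ ^ 2 ≤ Kw) (tw₁ : 3 * Cw₁ * ρ₃ ^ 2 ≤ Kw * x) (tw₀ : 3 * Cw₀ * ρ₃ ^ 2 ≤ Kw * x ^ 2)
    -- the tower's weight, dominated by the spatial rate
    {Λw D : ℝ} (hΛw : 0 ≤ Λw) (hD : 1 ≤ D) (hdom : Λw ≤ D * (ρ / x)) :
    ∀ (X : SpaceTimeIdx L M × SectorLeg (sectorCount (m + 1))) (t : ImagTimeIdx M) (ℓ : SectorLeg (sectorCount (m + 1))),
      ∑ y : TorusSite 2 L,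
        ‖((sectorSubMatrix L M β (bgmFatMultiplier L M e₀ β (nambuXiCT L μ K') (m + 1))).transpose * hubbardCovSliceCT L M β μ 0 K Λ Λ' *
            sectorSubMatrix L M β (bgmFatMultiplier L M e₀ β (nambuXiCT L μ K') (m + 1)) -
          (sectorSubMatrix L M β (bgmFatMultiplier L M e₀ β (nambuXiCT L μ K) (m + 1))).transpose * hubbardCovSliceCT L M β μ 0 K Λ Λ' *
            sectorSubMatrix L M β (bgmFatMultiplier L M e₀ β (nambuXiCT L μ K) (m + 1))) X ((t, y), ℓ)‖ *
          (1 + Λw * (Torus.tnorm (X.1.2 - y) : ℝ)) ≤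
      2 * (D * ((klScale e₀ m * β / π + 3) *
        (x * Real.sqrt (524288 * (1 / s₀ + 1) * ((1 + 4 * Real.sqrt 2) ^ 2 * ((2 * Real.sqrt 2 / ρ + 2) * (2 * Real.sqrt 2 / ρ₃ + 2)) + (1 / ρ + 1) ^ 2)) *
          Real.sqrt (24 * (L : ℝ) ^ 2 *
            ((Real.sqrt 2 * L * ((klScale e₀ m + (4 + 4 * A) * ρf ^ 2) / (2 * B.rhomin - 4 * A)) / π + 2) *
              (Real.sqrt 2 * L * (2 * ρf) / π + 2))) *
          (B₀x * ((1 / (β * (L : ℝ) ^ 2)) ^ 2 * (4 * (β * (L : ℝ) ^ 2) / Λ))))) + D * ((klScale e₀ m * β / π + 3) *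
        (x * Real.sqrt (524288 * (1 / s₀ + 1) * ((1 + 4 * Real.sqrt 2) ^ 2 * ((2 * Real.sqrt 2 / ρ + 2) * (2 * Real.sqrt 2 / ρ₃ + 2)) + (1 / ρ + 1) ^ 2)) *
          Real.sqrt (24 * (L : ℝ) ^ 2 *
            ((Real.sqrt 2 * L * ((klScale e₀ m + (4 + 4 * A) * ρf ^ 2) / (2 * B.rhomin - 4 * A)) / π + 2) *
              (Real.sqrt 2 * L * (2 * ρf) / π + 2))) *
          (B₀x * ((1 / (β * (L : ℝ) ^ 2)) ^ 2 * (4 * (β * (L : ℝ) ^ 2) / Λ)))))) := by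
  have hx0 : 0 < x := lt_of_lt_of_le one_pos hx
  have hG₁x : 0 ≤ G₁ / x := by positivity
  -- the two pieces on `Fin 2 → ℝ` and their jets (`‖toLp‖ ≤ 2`)
  have hf : ContDiff ℝ 3 (fun p : Momentum => frameLevel μ K' p - frameLevel μ K p) :=
    ((EngineV8.contDiff_frameLevel μ K').sub (EngineV8.contDiff_frameLevel μ K)).of_le (by norm_cast)
  set ν₂ : (Fin 2 → ℝ) → ℝ := fun p => frameLevel μ K' (WithLp.toLp 2 p) - frameLevel μ K (WithLp.toLp 2 p) with hν₂def
  set ν₁ : (Fin 2 → ℝ) → ℝ := fun p => frameLevel μ K (WithLp.toLp 2 p) - frameLevel μ K' (WithLp.toLp 2 p) with hν₁def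
  have hν₂c : ν₂ = (fun p : Momentum => frameLevel μ K' p - frameLevel μ K p) ∘ ((EuclideanSpace.equiv (Fin 2) ℝ).symm.toContinuousLinearMap) := by
    funext p; rfl
  have hν₁n : ν₁ = fun p => -ν₂ p := by funext p; simp only [hν₁def, hν₂def]; ring
  have hν₂s : ContDiff ℝ 3 ν₂ := by rw [hν₂c]; exact hf.comp (ContinuousLinearMap.contDiff _)
  have hν₁s : ContDiff ℝ 3 ν₁ := by rw [hν₁n]; exact hν₂s.neg
  have hjet : ∀ {j : ℕ} (hj : j ≤ 3) {Aj : ℝ}, (∀ p : Momentum, ‖iteratedFDeriv ℝ j (fun p : Momentum => frameLevel μ K' p - frameLevel μ K p) p‖ ≤ Aj) →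
      ∀ k, ‖iteratedFDeriv ℝ j ν₂ k‖ ≤ Aj * 2 ^ j := by
    intro j hj Aj hAj k
    exact norm_iteratedFDeriv_comp_toLp_le (hf.of_le (by exact_mod_cast hj)) hAj k
  have hN₀₂ : ∀ p, |ν₂ p| ≤ G₀ / x ^ 2 := fun p => hv₀ _
  have hN₁₂ : ∀ p, ‖fderiv ℝ ν₂ p‖ ≤ 2 * G₁ / x := fun p => by
    have h := hjet (j := 1) (by norm_num) (Aj := G₁ / x) (fun q => by rw [norm_iteratedFDeriv_one]; exact hv₁ q) p
    rw [norm_iteratedFDeriv_one] at h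
    exact h.trans (le_of_eq (by ring))
  have hN₂₂ : ∀ p, ‖iteratedFDeriv ℝ 2 ν₂ p‖ ≤ 4 * G₂ := fun p => (hjet (j := 2) (by norm_num) hv₂ p).trans (le_of_eq (by ring))
  have hN₃₂ : ∀ p, ‖iteratedFDeriv ℝ 3 ν₂ p‖ ≤ 8 * G₃ * x := fun p => (hjet (j := 3) le_rfl hv₃ p).trans (le_of_eq (by ring))
  have hN₀₁ : ∀ p, |ν₁ p| ≤ G₀ / x ^ 2 := fun p => by rw [hν₁n, abs_neg]; exact hN₀₂ p
  have hN₁₁ : ∀ p, ‖fderiv ℝ ν₁ p‖ ≤ 2 * G₁ / x := fun p => by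
    rw [hν₁n, show (fun p => -ν₂ p) = -ν₂ from rfl, fderiv_neg, norm_neg]; exact hN₁₂ p
  have hN₂₁ : ∀ p, ‖iteratedFDeriv ℝ 2 ν₁ p‖ ≤ 4 * G₂ := fun p => by
    rw [hν₁n, show (fun p => -ν₂ p) = -ν₂ from rfl, iteratedFDeriv_neg_apply, norm_neg]; exact hN₂₂ p
  have hN₃₁ : ∀ p, ‖iteratedFDeriv ℝ 3 ν₁ p‖ ≤ 8 * G₃ * x := fun p => by
    rw [hν₁n, show (fun p => -ν₂ p) = -ν₂ from rfl, iteratedFDeriv_neg_apply, norm_neg]; exact hN₃₂ p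
  -- tangency transfers: none for the first pair, `G₁/x` for the second
  have hNt₁ : ∀ (y w : EuclideanSpace ℝ (Fin 2)), |fderiv ℝ (frameLevel μ K) y w - fderiv ℝ (frameLevel μ K) y w| ≤ 0 * ‖w‖ := fun y w => by
    rw [sub_self, abs_zero, zero_mul]
  have hNt₂ : ∀ (y w : EuclideanSpace ℝ (Fin 2)), |fderiv ℝ (frameLevel μ K) y w - fderiv ℝ (frameLevel μ K') y w| ≤ G₁ / x * ‖w‖ := by
    intro y w
    have hdK : DifferentiableAt ℝ (frameLevel μ K) y := (EngineV8.contDiff_frameLevel μ K : ContDiff ℝ 1 (frameLevel μ K)).differentiable (by simp) y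
    have hdK' : DifferentiableAt ℝ (frameLevel μ K') y := (EngineV8.contDiff_frameLevel μ K' : ContDiff ℝ 1 (frameLevel μ K')).differentiable (by simp) y
    have hfd : fderiv ℝ (fun p => frameLevel μ K' p - frameLevel μ K p) y = fderiv ℝ (frameLevel μ K') y - fderiv ℝ (frameLevel μ K) y :=
      fderiv_fun_sub hdK' hdK
    have e : fderiv ℝ (frameLevel μ K) y w - fderiv ℝ (frameLevel μ K') y w = -(fderiv ℝ (fun p => frameLevel μ K' p - frameLevel μ K p) y w) := by
      rw [hfd]; simp only [sub_apply]; ring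
    rw [e, abs_neg, ← Real.norm_eq_abs]
    exact (ContinuousLinearMap.le_opNorm _ _).trans (mul_le_mul_of_nonneg_right (hv₁ y) (norm_nonneg _))
  have htvb₁ : tv + 0 ≤ bs := by linarith only [htvb, hG₁x]
  have h2G₁ : 0 ≤ 2 * G₁ := by positivity
  have h4G₂ : 0 ≤ 4 * G₂ := by positivity
  have h8G₃ : 0 ≤ 8 * G₃ := by positivity
  -- the two uniform sectional per-pair bounds (S1)
  have hT₁ := slicePairWt_bgmFatIncr_sectional_le_all B K' K hA hA3 hADt he hz hz1 hgap h3 hlo hhi hβ hρA m hMm hd hd1 hd2 hd3 hd4 hB0 hB hK₂ hNr hLz (fun p => rfl) hν₁s hx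
    hG₀ h2G₁ h4G₂ h8G₃ hε₃₀ hε₃₁ hN₀₁ hN₁₁ hN₂₁ hN₃₁ hGΛ hA₃x hΛ hΛΛ' hKb₁ hKb₂ hKb₃ hbs hKb₁b hKb₂x hKb₃x hB₁ hB₂ hB₃ le_rfl hNt₁
    hρf hκ hC₁ hB₀x hε₂ hζ ht h𝔮₁ h𝔮₂ h𝔮₃₀ h𝔮₃₁
    hd₁ hw₁ hd₂ hw₂ hd₃₀ hd₃₁ hw₃₀ hw₃₁ ho₁₀ ho₁₁ ho₂₀ ho₂₁ ho₂₂ ho₃₀ ho₃₁ ho₃₂ ho₃₃ hR₁₀ hR₁₁ hR₂₀ hR₂₁ hR₂₂ hR₃₀ hR₃₁ hR₃₂ hR₃₃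
    hr₁₀ hr₁₁ hr₂₀ hr₂₁ hr₂₂ hr₃₀ hr₃₁ hr₃₂ hr₃₃ htv h𝔳₁ h𝔳₂ h𝔳₃₀ h𝔳₃₁
    hdv₁ hwv₁ hdv₂ hwv₂ hdv₃₀ hdv₃₁ hwv₃₀ hwv₃₁ hov₁₀ hov₁₁ hov₂₀ hov₂₁ hov₂₂ hov₃₀ hov₃₁ hov₃₂ hov₃₃ hRv₁₀ hRv₁₁ hRv₂₀ hRv₂₁ hRv₂₂ hRv₃₀ hRv₃₁ hRv₃₂ hRv₃₃
    hrv₁₀ hrv₁₁ hrv₂₀ hrv₂₁ hrv₂₂ hrv₃₀ hrv₃₁ hrv₃₂ hrv₃₃ hqt₁ hqt₂ hqt₃ hDt₁ hDt₂ hθ₁ hθ₂ hθ₃ htvb₁ hLe hLv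
    hs₀ hρ hρ₃ hk₁ hk₂ hk₃ hC₀ hC₁' hC₂ hC₃ hCv₀ hCv₁ hCv₂ hCv₃ hCw₀ hCw₁ hCw₂ hKc hKw th₃ th₂ th₁ th₀ tv₃ tv₂ tv₁ tv₀ tw₂ tw₁ tw₀
  have hT₂ := slicePairWt_bgmFatIncr_sectional_le_all B K K hA' hA3' hADt he hz hz1 hgap h3 hlo hhi hβ hρA m hMm hd hd1 hd2 hd3 hd4 hB0 hB hK₂' hNr hLz (fun p => rfl) hν₂s hx
    hG₀ h2G₁ h4G₂ h8G₃ hε₃₀ hε₃₁ hN₀₂ hN₁₂ hN₂₂ hN₃₂ hGΛ hA₃x hΛ hΛΛ' hKb₁ hKb₂ hKb₃ hbs hKb₁b hKb₂x hKb₃x hB₁ hB₂ hB₃ hG₁x hNt₂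
    hρf hκ hC₁ hB₀x hε₂ hζ ht h𝔮₁ h𝔮₂ h𝔮₃₀ h𝔮₃₁
    hd₁ hw₁ hd₂ hw₂ hd₃₀ hd₃₁ hw₃₀ hw₃₁ ho₁₀ ho₁₁ ho₂₀ ho₂₁ ho₂₂ ho₃₀ ho₃₁ ho₃₂ ho₃₃ hR₁₀ hR₁₁ hR₂₀ hR₂₁ hR₂₂ hR₃₀ hR₃₁ hR₃₂ hR₃₃
    hr₁₀ hr₁₁ hr₂₀ hr₂₁ hr₂₂ hr₃₀ hr₃₁ hr₃₂ hr₃₃ htv h𝔳₁ h𝔳₂ h𝔳₃₀ h𝔳₃₁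
    hdv₁ hwv₁ hdv₂ hwv₂ hdv₃₀ hdv₃₁ hwv₃₀ hwv₃₁ hov₁₀ hov₁₁ hov₂₀ hov₂₁ hov₂₂ hov₃₀ hov₃₁ hov₃₂ hov₃₃ hRv₁₀ hRv₁₁ hRv₂₀ hRv₂₁ hRv₂₂ hRv₃₀ hRv₃₁ hRv₃₂ hRv₃₃
    hrv₁₀ hrv₁₁ hrv₂₀ hrv₂₁ hrv₂₂ hrv₃₀ hrv₃₁ hrv₃₂ hrv₃₃ hqt₁ hqt₂ hqt₃ hDt₁ hDt₂ hθ₁ hθ₂ hθ₃ htvb hLe hLv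
    hs₀ hρ hρ₃ hk₁ hk₂ hk₃ hC₀ hC₁' hC₂ hC₃ hCv₀ hCv₁ hCv₂ hCv₃ hCw₀ hCw₁ hCw₂ hKc hKw th₃ th₂ th₁ th₀ tv₃ tv₂ tv₁ tv₀ tw₂ tw₁ tw₀
  -- assemble at fixed `(X, t, ℓ)`: split, convert the rate weight, p3 g13's sectional family-row lemma
  intro X t ℓ
  refine secRowWt_sliceCT_familySub_le hβ.ne' μ K Λ Λ' (bgmFatMultiplier L M e₀ β (nambuXiCT L μ K') (m + 1)) (bgmFatMultiplier L M e₀ β (nambuXiCT L μ K) (m + 1))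
    hΛw X t ℓ fun z₁ => ?_
  have hA₁ := secWt_tnorm_le_of_rateWt hD hΛw hdom _ (fun z₂ => norm_nonneg _) (hT₂ X.2.1.1 ℓ.1.1 z₁)
  have hA₂ := secWt_tnorm_le_of_rateWt hD hΛw hdom _ (fun z₂ => norm_nonneg _) (hT₁ ℓ.1.1 X.2.1.1 z₁)
  beta_reduce at hA₁ hA₂
  refine le_trans (Finset.sum_le_sum fun z₂ _ => mul_le_mul_of_nonneg_left
    (norm_charSum_pairSub_le_add_incr ((((1 / (β * (L : ℝ) ^ 2) : ℝ) : ℂ)) ^ 2) (bgmFatMultiplier L M e₀ β (nambuXiCT L μ K') (m + 1))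
      (bgmFatMultiplier L M e₀ β (nambuXiCT L μ K) (m + 1))
      (fun ks => sliceSymbolFnXi (β * (L : ℝ) ^ 2) 0 Λ Λ' (matsubaraFreq β M ks.1) (nambuXiCT L μ K ks.2)) X.2.1.1 ℓ.1.1 z₁ z₂) (by positivity)) ?_
  refine (Finset.sum_congr rfl fun z₂ _ => mul_add _ _ _).trans_le ?_
  rw [Finset.sum_add_distrib]
  exact add_le_add hA₁ hA₂

end FamDefectSec

end Summit.HubbardSuperconductivity.HubbardSuperconductivity.Theorems.TorusFourierL2

end
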